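import Summits.CriticalPhenomena.PercolationContinuityZ3.Theorems.PercNearOneGluingNoHeavyLowerTailAntitheticPositivePart
import Summits.CriticalPhenomena.PercolationContinuityZ3.Theorems.PercNearOneGluingNoHeavyLowerTailAntitheticTwinTop
import HarnessLib

/-!
# `NoHeavyLowerTail` (stmt-CriticalPhenomena-4575) — antithetic cluster pairs: **ANCHOR BOXES AT A TWIN** — tools for THEOREM TW
# (the top event at EVERY twin of the source; prim-hp-2 gen 74, HOME/THEOREM-TWIN.md, HOME/MEMO-gen74.md)

Support file (`--supports stmt-CriticalPhenomena-4575`, hull-port prover `prim-hp-2`, gen 74).  No definitions, no named facts, no sorries;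
standard axioms.  Notation of …AntitheticTwinTop: colourings `T ⊆ Sym2 V`, `X T = openCluster (T ∩ E) s`, `Y T = openCluster (Tᶜ ∩ E) s`;
twins `s ≠ P` (`htwin`, `sP ∉ E`); `K₁, K₂` super-odd twisted-monotone kernels.

THEOREM TW (…AntitheticTwinTopAll, this generation) says that the top sum `Σ_{P ∈ X T, P ∉ Y T} K₁K₂` is nonnegative at EVERY pair of
non-adjacent twins, with no hypothesis on the rest of the graph.  Its proof pairs each colouring `T₀` of the top event WITHOUT a red–red
common neighbour with the ANCHOR colouring `T₀ ∪ {sv : Pv red}` (all pairs at `s` red): the anchor has the same red cluster, blue cluster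
`{s}`, and lies in the top event; on each ANCHOR BOX (pairs at `s` all red, pairs `Pv` red exactly for `v ∈ R`) THEOREM W
(…AntitheticPositivePart) bounds the pulled-back sum below by minus `Σ (K₁)₊(K₂)₊`, which the anchor terms `K₁K₂(X T, {s})` dominate.
This file supplies the pieces:
* `Antithetic.PosPart.box_sum_ge` — THEOREM W transported to a box (fixed pattern on `Fix`, free elsewhere): for `Wr` increasing, `Wb`
  decreasing with `Wb T' ⊆ Wr T` for box members opposite off `Fix`, and a weight `0 ≤ u` increasing,
  `Σ_box u·[(K₁)₋(K₂)₋ − (K₁)₊(K₂)₊](Wr, Wb) ≤ Σ_box u·K₁K₂(Wr, Wb)`;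
* `Antithetic.Twin.blue_eq_singleton_of_red_at_source` — all `E`-pairs at `s` red ⇒ `Y T = {s}`;
* `Antithetic.Twin.exists_red_pair_of_mem_red` — `P ∈ X T`, `P ≠ s` ⇒ some pair `Pw ∈ E` is red;
* `Antithetic.Twin.red_eq_of_anchor` — adding red pairs `sv` towards common neighbours does not change the red cluster on the top event;
* `Antithetic.Twin.dom_anchor` — red domination of the pulled-back blue clusters on an anchor box;
* `Antithetic.Twin.kernel_anchor_ge_posPart` — `K(A, {s}) ≥ max(K(A, B), 0)` for `s ∈ A`, `s ∈ B`;
* `Antithetic.Twin.top_rr_br_sum_nonneg` — the part of the red–red top event with SOME blue pair at `s` is nonnegative (type boxes,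
  `Box.freeze_boxes_sum_nonneg`, as in `Twin.top_rr_sum_nonneg`).
[cite: VandenbergHaggstromKahn2005, §1 p. 6 ("Harris' inequality"), §1 p. 3 (open cluster `C_s`)]
-/

noncomputable section

namespace Summit.CriticalPhenomena.PercolationContinuityZ3.Theorems

open Literature.Probability.Percolation
open scoped Classical

namespace Antithetic

namespace PosPart

variable {V : Type*} [Fintype V]

/-- **THEOREM W on a box.**  `Fix, N ⊆ Sym2 V`; the box is `{T : ∀ e ∈ Fix, e ∈ T ↔ e ∈ N}`.  `Wr` increasing, `Wb` decreasing set-valued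
functions of the colouring with `Wb T' ⊆ Wr T` whenever `T, T'` lie in the box and are opposite off `Fix`; `u ≥ 0` increasing; `K₁, K₂`
super-odd twisted-monotone.  Then `Σ_box u·[(K₁)₋(K₂)₋ − (K₁)₊(K₂)₊] ≤ Σ_box u·K₁K₂` (kernels at `(Wr T, Wb T)`). [this work] -/
theorem box_sum_ge (Fix N : Set (Sym2 V)) (Wr Wb : Set (Sym2 V) → Set V) (hWr : Monotone Wr) (hWb : Antitone Wb)
    (hdom : ∀ T T' : Set (Sym2 V), (∀ e ∈ Fix, (e ∈ T ↔ e ∈ N)) → (∀ e ∈ Fix, (e ∈ T' ↔ e ∈ N)) →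
      (∀ e ∉ Fix, (e ∈ T' ↔ e ∉ T)) → Wb T' ⊆ Wr T)
    {K₁ K₂ : Set V → Set V → ℝ}
    (hK₁ : ∀ ⦃P P' Q Q' : Set V⦄, P ⊆ P' → Q' ⊆ Q → K₁ P Q ≤ K₁ P' Q') (hso₁ : ∀ P Q, 0 ≤ K₁ P Q + K₁ Q P)
    (hK₂ : ∀ ⦃P P' Q Q' : Set V⦄, P ⊆ P' → Q' ⊆ Q → K₂ P Q ≤ K₂ P' Q') (hso₂ : ∀ P Q, 0 ≤ K₂ P Q + K₂ Q P)
    {u : Set (Sym2 V) → ℝ} (hu0 : ∀ T, 0 ≤ u T) (hu : Monotone u) :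
    ∑ T ∈ Finset.univ.filter (fun T : Set (Sym2 V) => ∀ e ∈ Fix, (e ∈ T ↔ e ∈ N)),
      u T * (max (-K₁ (Wr T) (Wb T)) 0 * max (-K₂ (Wr T) (Wb T)) 0 - max (K₁ (Wr T) (Wb T)) 0 * max (K₂ (Wr T) (Wb T)) 0) ≤
    ∑ T ∈ Finset.univ.filter (fun T : Set (Sym2 V) => ∀ e ∈ Fix, (e ∈ T ↔ e ∈ N)),
      u T * (K₁ (Wr T) (Wb T) * K₂ (Wr T) (Wb T)) := by
  let mem : Set (Sym2 V) → Prop := fun T => ∀ e ∈ Fix, (e ∈ T ↔ e ∈ N)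
  let Ψ : Set (Sym2 V) → ℝ := fun T => u T * (K₁ (Wr T) (Wb T) * K₂ (Wr T) (Wb T)) -
    u T * (max (-K₁ (Wr T) (Wb T)) 0 * max (-K₂ (Wr T) (Wb T)) 0 - max (K₁ (Wr T) (Wb T)) 0 * max (K₂ (Wr T) (Wb T)) 0)
  rw [← sub_nonneg, ← Finset.sum_sub_distrib]
  show 0 ≤ ∑ T ∈ Finset.univ.filter (fun T => mem T), Ψ T
  -- parametrise the box by the free pairs
  let ι := {e : Sym2 V // e ∉ Fix}
  let base : Set (Sym2 V) := N ∩ Fix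
  let emb : Set ι → Set (Sym2 V) := fun S => base ∪ {e | ∃ h : e ∉ Fix, (⟨e, h⟩ : ι) ∈ S}
  let proj : Set (Sym2 V) → Set ι := fun T => {p | p.1 ∈ T}
  have hemb_mono : Monotone emb := by
    intro S S' h e he
    rcases he with he | ⟨hne, hmem⟩
    · exact Or.inl he
    · exact Or.inr ⟨hne, h hmem⟩
  have hemb_mem : ∀ S, mem (emb S) := by
    intro S e he
    constructor
    · rintro (h | ⟨hne, _⟩)
      · exact h.1
      · exact absurd he hne
    · exact fun h => Or.inl ⟨h, he⟩
  have hemb_off : ∀ S (e : Sym2 V) (h : e ∉ Fix), e ∈ emb S ↔ (⟨e, h⟩ : ι) ∈ S := by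
    intro S e h
    constructor
    · rintro (h' | ⟨_, h'⟩)
      · exact absurd h'.2 h
      · exact h'
    · exact fun h' => Or.inr ⟨h, h'⟩
  have hdom' : ∀ S : Set ι, Wb (emb Sᶜ) ⊆ Wr (emb S) := by
    intro S
    refine hdom (emb S) (emb Sᶜ) (hemb_mem S) (hemb_mem Sᶜ) fun e he => ?_
    rw [hemb_off Sᶜ e he, hemb_off S e he, Set.mem_compl_iff]
  have hcube := sum_ge_negParts_sub_posParts (fun S : Set ι => Wr (emb S)) (fun S : Set ι => Wb (emb S))
    (fun S S' h => hWr (hemb_mono h)) (fun S S' h => hWb (hemb_mono h)) hdom' hK₁ hso₁ hK₂ hso₂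
    (u := fun S => u (emb S)) (fun S => hu0 _) (fun S S' h => hu (hemb_mono h))
  have hcube' : 0 ≤ ∑ S : Set ι, Ψ (emb S) := by
    rw [← sub_nonneg, ← Finset.sum_sub_distrib] at hcube
    exact hcube
  -- transport the cube sum to the box
  have hbij : ∑ S : Set ι, Ψ (emb S) = ∑ T ∈ Finset.univ.filter (fun T => mem T), Ψ T := by
    refine Finset.sum_nbij' emb proj ?_ ?_ ?_ ?_ ?_
    · intro S _
      exact Finset.mem_filter.2 ⟨Finset.mem_univ _, hemb_mem S⟩
    · intro T _; exact Finset.mem_univ _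
    · intro S _
      ext p
      simp only [proj, Set.mem_setOf_eq]
      exact hemb_off S p.1 p.2
    · intro T hT
      have hT' : mem T := (Finset.mem_filter.1 hT).2
      ext e
      by_cases he : e ∈ Fix
      · rw [hT' e he]
        constructor
        · rintro (h | ⟨hne, _⟩)
          · exact h.1
          · exact absurd he hne
        · exact fun h => Or.inl ⟨h, he⟩
      · rw [hemb_off (proj T) e he]
        rfl
    · intro S _; rfl
  rw [← hbij]; exact hcube'

end PosPart

namespace Twin

variable {V : Type*}

section Clusters

variable {E : Set (Sym2 V)} {s P : V}

/-- If every `E`-pair at `s` is red then the blue cluster of `s` is `{s}`. [folklore] -/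
theorem blue_eq_singleton_of_red_at_source {T : Set (Sym2 V)} (hall : ∀ v, v ≠ s → s(s, v) ∈ E → s(s, v) ∈ T) :
    openCluster (Tᶜ ∩ E) s = {s} := by
  apply Set.Subset.antisymm
  · refine TwoStage.Fan.cluster_subset_of_closed (S := ({s} : Set V)) rfl fun u w hu huw => ?_
    rw [Set.mem_singleton_iff] at hu
    subst hu
    obtain ⟨⟨hTb, hE⟩, hne⟩ := (openGraph_adj _ u w).1 huw
    exact absurd (hall w (Ne.symm hne) hE) hTb
  · rintro x hx
    rw [Set.mem_singleton_iff] at hx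
    subst hx
    exact mem_openCluster_self _ _

/-- A vertex `P ≠ s` of the red cluster carries a red `E`-pair. [folklore] -/
theorem exists_red_pair_of_mem_red {T : Set (Sym2 V)} (hsP : s ≠ P) (hPX : P ∈ openCluster (T ∩ E) s) :
    ∃ w, w ≠ P ∧ s(P, w) ∈ E ∧ s(P, w) ∈ T := by
  by_contra h
  have hsub : openCluster (T ∩ E) s ⊆ {x | x ≠ P} := by
    refine TwoStage.Fan.cluster_subset_of_closed (S := {x | x ≠ P}) hsP fun u w hu huw => ?_
    obtain ⟨⟨hT, hE⟩, hne⟩ := (openGraph_adj _ u w).1 huw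
    intro hwP
    rw [Set.mem_setOf_eq] at hu
    have huP : u ≠ P := fun h' => hne (h'.trans hwP.symm)
    refine h ⟨u, huP, ?_, ?_⟩
    · rw [Sym2.eq_swap, ← hwP]; exact hE
    · rw [Sym2.eq_swap, ← hwP]; exact hT
  exact hsub hPX rfl

/-- **Anchoring does not change the red cluster on the top event.**  Twins `s, P`; `S` a set of pairs `sv` towards common neighbours;
if `T ∖ S` (more generally any `T₀ ⊆ T` with `T ⊆ T₀ ∪ S`) lies in the top event then `X T = X T₀`. [this work] -/
theorem red_eq_of_anchor (htwin : ∀ v, v ≠ s → v ≠ P → (s(s, v) ∈ E ↔ s(P, v) ∈ E)) {S T₀ T : Set (Sym2 V)}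
    (hS : ∀ e ∈ S, ∃ v, v ≠ s ∧ v ≠ P ∧ s(s, v) ∈ E ∧ e = s(s, v)) (hT₀T : T₀ ⊆ T) (hTT₀ : T ⊆ T₀ ∪ S)
    (hPX : P ∈ openCluster (T₀ ∩ E) s) (hPY : P ∉ openCluster (T₀ᶜ ∩ E) s) :
    openCluster (T ∩ E) s = openCluster (T₀ ∩ E) s := by
  apply Set.Subset.antisymm
  · refine TwoStage.Fan.cluster_subset_of_closed (mem_openCluster_self _ s) fun u w hu huw => ?_
    obtain ⟨⟨hT, hE⟩, hne⟩ := (openGraph_adj _ u w).1 huw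
    rcases hTT₀ hT with h | h
    · exact mem_red_of_pair hu h hE hne
    · obtain ⟨v, hvs, hvP, hvE, he⟩ := hS _ h
      have hv : v ∈ openCluster (T₀ ∩ E) s := nbr_mem_red_of_top htwin hPX hPY hvs hvP hvE
      have hw : w = s ∨ w = v := by
        have : w ∈ s(s, v) := by rw [← he]; exact Sym2.mem_mk_right u w
        exact Sym2.mem_iff.1 this
      rcases hw with rfl | rfl
      · exact mem_openCluster_self _ _
      · exact hv
  · exact Freeze.openCluster_mono (Set.inter_subset_inter_left E hT₀T) s

/-- **Red domination on an anchor box.**  Twins `s ≠ P`, `sP ∉ E`; `R` a set of common neighbours containing some `j`; the box: every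
`E`-pair `sv` (v a common neighbour) red, `Pv` red iff `v ∈ R`; `S = {sv : v ∈ R}`.  If `T, T'` lie in the box and are opposite on every
pair avoiding `s` and `P`, then `Y (T' ∖ S) ⊆ X T`. [this work] -/
theorem dom_anchor (hsP : s ≠ P) (hsPE : s(s, P) ∉ E) (htwin : ∀ v, v ≠ s → v ≠ P → (s(s, v) ∈ E ↔ s(P, v) ∈ E))
    {R : Set V} (hR : ∀ v ∈ R, v ≠ s ∧ v ≠ P ∧ s(s, v) ∈ E) {j : V} (hj : j ∈ R)
    {T T' : Set (Sym2 V)}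
    (hTs : ∀ v, v ≠ s → v ≠ P → s(s, v) ∈ E → s(s, v) ∈ T) (hTP : ∀ v, v ≠ s → v ≠ P → s(s, v) ∈ E → (s(P, v) ∈ T ↔ v ∈ R))
    (hT's : ∀ v, v ≠ s → v ≠ P → s(s, v) ∈ E → s(s, v) ∈ T') (hT'P : ∀ v, v ≠ s → v ≠ P → s(s, v) ∈ E → (s(P, v) ∈ T' ↔ v ∈ R))
    (hflip : ∀ e : Sym2 V, ¬ (s ∈ e ∨ P ∈ e) → (e ∈ T' ↔ e ∉ T)) :
    openCluster ((T' \ {e | ∃ v ∈ R, e = s(s, v)})ᶜ ∩ E) s ⊆ openCluster (T ∩ E) s := by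
  have hPX : P ∈ openCluster (T ∩ E) s :=
    mem_red_of_rr htwin (hR j hj).1 (hR j hj).2.1 (hR j hj).2.2 (hTs j (hR j hj).1 (hR j hj).2.1 (hR j hj).2.2)
      ((hTP j (hR j hj).1 (hR j hj).2.1 (hR j hj).2.2).2 hj)
  refine TwoStage.Fan.cluster_subset_of_closed (mem_openCluster_self _ s) fun u w hu huw => ?_
  obtain ⟨⟨hTb, hE⟩, hne⟩ := (openGraph_adj _ u w).1 huw
  -- `hTb : s(u, w) ∉ T' \ S`
  by_cases hT'uw : s(u, w) ∈ T'
  · -- the pair lies in `S`: it is `s(s, v)` with `v ∈ R`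
    have hSuw : s(u, w) ∈ {e : Sym2 V | ∃ v ∈ R, e = s(s, v)} := by
      by_contra hn
      exact hTb ⟨hT'uw, hn⟩
    obtain ⟨v, hv, he⟩ := hSuw
    have hvX : v ∈ openCluster (T ∩ E) s :=
      mem_red_of_pair (mem_openCluster_self _ s) (hTs v (hR v hv).1 (hR v hv).2.1 (hR v hv).2.2) (hR v hv).2.2 (hR v hv).1.symm
    have hw : w = s ∨ w = v := by
      have : w ∈ s(s, v) := by rw [← he]; exact Sym2.mem_mk_right u w
      exact Sym2.mem_iff.1 this
    rcases hw with rfl | rfl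
    · exact mem_openCluster_self _ _
    · exact hvX
  · -- the pair is blue in `T'`
    by_cases hA : s ∈ s(u, w) ∨ P ∈ s(u, w)
    · rcases hA with hA | hA
      · -- a pair at `s`: its other end is a common neighbour, so the pair is red in `T'`: impossible
        exfalso
        rcases Sym2.mem_iff.1 hA with h | h
        · subst h
          have hwP : w ≠ P := fun h' => hsPE (h' ▸ hE)
          exact hT'uw (hT's w (Ne.symm hne) hwP hE)
        · subst h
          have huP : u ≠ P := fun h' => hsPE (by rw [Sym2.eq_swap]; exact h' ▸ hE)
          exact hT'uw (by rw [Sym2.eq_swap]; exact hT's u hne huP (by rw [Sym2.eq_swap]; exact hE))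
      · -- a pair at `P`: both ends lie in `X T`
        rcases Sym2.mem_iff.1 hA with h | h
        · subst h
          -- `u = P`, `w` a common neighbour
          have hws : w ≠ s := fun h' => hsPE (by rw [Sym2.eq_swap]; exact h' ▸ hE)
          have hwE : s(s, w) ∈ E := (htwin w hws (Ne.symm hne)).2 hE
          exact mem_red_of_pair (mem_openCluster_self _ s) (hTs w hws (Ne.symm hne) hwE) hwE hws.symm
        · subst h
          exact hPX
    · -- a free pair: blue in `T'` means red in `T`
      have hTr : s(u, w) ∈ T := by
        by_contra h
        exact hT'uw ((hflip _ hA).2 h)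
      exact mem_red_of_pair hu hTr hE hne

end Clusters

/-- `K(A, {s}) ≥ max(K(A, B), 0)` for a super-odd twisted-monotone kernel, `s ∈ A`, `s ∈ B`. [folklore] -/
theorem kernel_anchor_ge_posPart {K : Set V → Set V → ℝ}
    (hK : ∀ ⦃P P' Q Q' : Set V⦄, P ⊆ P' → Q' ⊆ Q → K P Q ≤ K P' Q') (hso : ∀ P Q, 0 ≤ K P Q + K Q P)
    {A B : Set V} {s : V} (hsA : s ∈ A) (hsB : s ∈ B) : max (K A B) 0 ≤ K A {s} := by
  refine max_le (hK subset_rfl (Set.singleton_subset_iff.2 hsB)) ?_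
  have h1 : K {s} A ≤ K A {s} := hK (Set.singleton_subset_iff.2 hsA) (Set.singleton_subset_iff.2 hsA)
  have h2 := hso A {s}
  linarith

variable [Fintype V]

/-- **The red–red top event with some blue pair at the source is nonnegative (every twin pair, `K`-form).**  As `Twin.top_rr_sum_nonneg`
with the extra (pattern-determined) condition "some common neighbour `v` has `sv` blue". [this work] -/
theorem top_rr_br_sum_nonneg (E : Set (Sym2 V)) (s P : V) (htwin : ∀ v, v ≠ s → v ≠ P → (s(s, v) ∈ E ↔ s(P, v) ∈ E))
    {K₁ K₂ : Set V → Set V → ℝ}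
    (hK₁ : ∀ ⦃A A' B B' : Set V⦄, A ⊆ A' → B' ⊆ B → K₁ A B ≤ K₁ A' B') (hso₁ : ∀ A B, 0 ≤ K₁ A B + K₁ B A)
    (hK₂ : ∀ ⦃A A' B B' : Set V⦄, A ⊆ A' → B' ⊆ B → K₂ A B ≤ K₂ A' B') (hso₂ : ∀ A B, 0 ≤ K₂ A B + K₂ B A) :
    0 ≤ ∑ T ∈ Finset.univ.filter (fun T : Set (Sym2 V) => P ∈ openCluster (T ∩ E) s ∧ P ∉ openCluster (Tᶜ ∩ E) s ∧
        (∃ v, v ≠ s ∧ v ≠ P ∧ s(s, v) ∈ E ∧ s(s, v) ∈ T ∧ s(P, v) ∈ T) ∧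
        (∃ v, v ≠ s ∧ v ≠ P ∧ s(s, v) ∈ E ∧ s(s, v) ∉ T)),
      K₁ (openCluster (T ∩ E) s) (openCluster (Tᶜ ∩ E) s) * K₂ (openCluster (T ∩ E) s) (openCluster (Tᶜ ∩ E) s) := by
  let A : Set (Sym2 V) := {e | s ∈ e ∨ P ∈ e}
  let good : Set (Sym2 V) → Prop := fun N =>
    (∃ v, v ≠ s ∧ v ≠ P ∧ s(s, v) ∈ E ∧ s(s, v) ∈ N ∧ s(P, v) ∈ N) ∧
    (∀ v, v ≠ s → v ≠ P → s(s, v) ∈ E → s(s, v) ∈ N ∨ s(P, v) ∈ N) ∧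
    (∃ v, v ≠ s ∧ v ≠ P ∧ s(s, v) ∈ E ∧ s(s, v) ∉ N)
  have hsA : ∀ v, s(s, v) ∈ A := fun v => Or.inl (Sym2.mem_mk_left s v)
  have hPA : ∀ v, s(P, v) ∈ A := fun v => Or.inr (Sym2.mem_mk_left P v)
  have hgood_iff : ∀ N M : Set (Sym2 V), (∀ e ∈ A, (e ∈ M ↔ e ∈ N)) → (good N ↔ good M) := by
    intro N M h
    constructor
    · rintro ⟨⟨v, hvs, hvP, hvE, h1, h2⟩, hno, ⟨w, hws, hwP, hwE, hw⟩⟩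
      exact ⟨⟨v, hvs, hvP, hvE, (h _ (hsA v)).2 h1, (h _ (hPA v)).2 h2⟩,
        fun v hvs hvP hvE => (hno v hvs hvP hvE).imp (h _ (hsA v)).2 (h _ (hPA v)).2,
        ⟨w, hws, hwP, hwE, fun h' => hw ((h _ (hsA w)).1 h')⟩⟩
    · rintro ⟨⟨v, hvs, hvP, hvE, h1, h2⟩, hno, ⟨w, hws, hwP, hwE, hw⟩⟩
      exact ⟨⟨v, hvs, hvP, hvE, (h _ (hsA v)).1 h1, (h _ (hPA v)).1 h2⟩,
        fun v hvs hvP hvE => (hno v hvs hvP hvE).imp (h _ (hsA v)).1 (h _ (hPA v)).1,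
        ⟨w, hws, hwP, hwE, fun h' => hw ((h _ (hsA w)).2 h')⟩⟩
  let C := {N : Set (Sym2 V) // N ⊆ A ∧ good N}
  let D : Finset (Set (Sym2 V)) := Finset.univ.filter fun T => good T
  have hfreeze := Box.freeze_boxes_sum_nonneg E s D (fun _ : C => A) (fun c : C => c.1)
    (fun T hT => ?_) (fun c T hT => ?_) (fun c c' T hc hc' => ?_) (fun c T T' hT hT' hflip => ?_) {P} hK₁ hso₁ hK₂ hso₂
  · have hev : D.filter (fun T => ∀ Q ∈ ({P} : Set V), Q ∉ openCluster (Tᶜ ∩ E) s) =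
        Finset.univ.filter (fun T : Set (Sym2 V) => P ∈ openCluster (T ∩ E) s ∧ P ∉ openCluster (Tᶜ ∩ E) s ∧
          (∃ v, v ≠ s ∧ v ≠ P ∧ s(s, v) ∈ E ∧ s(s, v) ∈ T ∧ s(P, v) ∈ T) ∧
          (∃ v, v ≠ s ∧ v ≠ P ∧ s(s, v) ∈ E ∧ s(s, v) ∉ T)) := by
      ext T
      simp only [D, Finset.mem_filter, Finset.mem_univ, true_and, Set.mem_singleton_iff, forall_eq]
      constructor
      · rintro ⟨⟨⟨v, hvs, hvP, hvE, h1, h2⟩, -, hbr⟩, hPY⟩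
        exact ⟨mem_red_of_rr htwin hvs hvP hvE h1 h2, hPY, ⟨v, hvs, hvP, hvE, h1, h2⟩, hbr⟩
      · rintro ⟨-, hPY, ⟨v, hvs, hvP, hvE, h1, h2⟩, hbr⟩
        exact ⟨⟨⟨v, hvs, hvP, hvE, h1, h2⟩, fun w hws hwP hwE => noBB_of_top htwin hPY hws hwP hwE, hbr⟩, hPY⟩
    rw [← hev]
    exact hfreeze
  · have hgT : good T := (Finset.mem_filter.1 hT).2
    refine ⟨⟨T ∩ A, Set.inter_subset_right, (hgood_iff T (T ∩ A) fun e he => ⟨fun h => h.1, fun h => ⟨h, he⟩⟩).1 hgT⟩,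
      fun e he => ⟨fun h => ⟨h, he⟩, fun h => h.1⟩⟩
  · exact Finset.mem_filter.2 ⟨Finset.mem_univ _, (hgood_iff c.1 T hT).1 c.2.2⟩
  · apply Subtype.ext
    ext e
    constructor
    · intro he
      exact (hc' e (c.2.1 he)).1 ((hc e (c.2.1 he)).2 he)
    · intro he
      exact (hc e (c'.2.1 he)).1 ((hc' e (c'.2.1 he)).2 he)
  · have hgT : good T := (hgood_iff c.1 T hT).1 c.2.2
    obtain ⟨⟨v, hvs, hvP, hvE, h1, h2⟩, hnoBB, -⟩ := hgT
    refine dom_of_types htwin (fun e he => ?_) (fun e he => hflip e he) (mem_red_of_rr htwin hvs hvP hvE h1 h2) hnoBB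
    exact (hT' e he).trans (hT e he).symm

end Twin

namespace PosPart

variable {V : Type*} [Fintype V]

/-- **THEOREM W on a box, explicit-Finset form**: as `box_sum_ge`, for any Finset `D` whose members are exactly the box. [this work] -/
theorem box_sum_ge_of_mem (Fix N : Set (Sym2 V)) (D : Finset (Set (Sym2 V))) (hD : ∀ T, T ∈ D ↔ ∀ e ∈ Fix, (e ∈ T ↔ e ∈ N))
    (Wr Wb : Set (Sym2 V) → Set V) (hWr : Monotone Wr) (hWb : Antitone Wb)
    (hdom : ∀ T T' : Set (Sym2 V), (∀ e ∈ Fix, (e ∈ T ↔ e ∈ N)) → (∀ e ∈ Fix, (e ∈ T' ↔ e ∈ N)) →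
      (∀ e ∉ Fix, (e ∈ T' ↔ e ∉ T)) → Wb T' ⊆ Wr T)
    {K₁ K₂ : Set V → Set V → ℝ}
    (hK₁ : ∀ ⦃P P' Q Q' : Set V⦄, P ⊆ P' → Q' ⊆ Q → K₁ P Q ≤ K₁ P' Q') (hso₁ : ∀ P Q, 0 ≤ K₁ P Q + K₁ Q P)
    (hK₂ : ∀ ⦃P P' Q Q' : Set V⦄, P ⊆ P' → Q' ⊆ Q → K₂ P Q ≤ K₂ P' Q') (hso₂ : ∀ P Q, 0 ≤ K₂ P Q + K₂ Q P)
    {u : Set (Sym2 V) → ℝ} (hu0 : ∀ T, 0 ≤ u T) (hu : Monotone u) :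
    ∑ T ∈ D, u T * (max (-K₁ (Wr T) (Wb T)) 0 * max (-K₂ (Wr T) (Wb T)) 0 - max (K₁ (Wr T) (Wb T)) 0 * max (K₂ (Wr T) (Wb T)) 0) ≤
    ∑ T ∈ D, u T * (K₁ (Wr T) (Wb T) * K₂ (Wr T) (Wb T)) := by
  let mem : Set (Sym2 V) → Prop := fun T => ∀ e ∈ Fix, (e ∈ T ↔ e ∈ N)
  let Ψ : Set (Sym2 V) → ℝ := fun T => u T * (K₁ (Wr T) (Wb T) * K₂ (Wr T) (Wb T)) -
    u T * (max (-K₁ (Wr T) (Wb T)) 0 * max (-K₂ (Wr T) (Wb T)) 0 - max (K₁ (Wr T) (Wb T)) 0 * max (K₂ (Wr T) (Wb T)) 0)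
  rw [← sub_nonneg, ← Finset.sum_sub_distrib]
  show 0 ≤ ∑ T ∈ D, Ψ T
  let ι := {e : Sym2 V // e ∉ Fix}
  let base : Set (Sym2 V) := N ∩ Fix
  let emb : Set ι → Set (Sym2 V) := fun S => base ∪ {e | ∃ h : e ∉ Fix, (⟨e, h⟩ : ι) ∈ S}
  let proj : Set (Sym2 V) → Set ι := fun T => {p | p.1 ∈ T}
  have hemb_mono : Monotone emb := by
    intro S S' h e he
    rcases he with he | ⟨hne, hmem⟩
    · exact Or.inl he
    · exact Or.inr ⟨hne, h hmem⟩
  have hemb_mem : ∀ S, mem (emb S) := by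
    intro S e he
    constructor
    · rintro (h | ⟨hne, _⟩)
      · exact h.1
      · exact absurd he hne
    · exact fun h => Or.inl ⟨h, he⟩
  have hemb_off : ∀ S (e : Sym2 V) (h : e ∉ Fix), e ∈ emb S ↔ (⟨e, h⟩ : ι) ∈ S := by
    intro S e h
    constructor
    · rintro (h' | ⟨_, h'⟩)
      · exact absurd h'.2 h
      · exact h'
    · exact fun h' => Or.inr ⟨h, h'⟩
  have hdom' : ∀ S : Set ι, Wb (emb Sᶜ) ⊆ Wr (emb S) := by
    intro S
    refine hdom (emb S) (emb Sᶜ) (hemb_mem S) (hemb_mem Sᶜ) fun e he => ?_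
    rw [hemb_off Sᶜ e he, hemb_off S e he, Set.mem_compl_iff]
  have hcube := sum_ge_negParts_sub_posParts (fun S : Set ι => Wr (emb S)) (fun S : Set ι => Wb (emb S))
    (fun S S' h => hWr (hemb_mono h)) (fun S S' h => hWb (hemb_mono h)) hdom' hK₁ hso₁ hK₂ hso₂
    (u := fun S => u (emb S)) (fun S => hu0 _) (fun S S' h => hu (hemb_mono h))
  have hcube' : 0 ≤ ∑ S : Set ι, Ψ (emb S) := by
    rw [← sub_nonneg, ← Finset.sum_sub_distrib] at hcube
    exact hcube
  have hbij : ∑ S : Set ι, Ψ (emb S) = ∑ T ∈ D, Ψ T := by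
    refine Finset.sum_nbij' emb proj ?_ ?_ ?_ ?_ ?_
    · intro S _
      exact (hD _).2 (hemb_mem S)
    · intro T _; exact Finset.mem_univ _
    · intro S _
      ext p
      simp only [proj, Set.mem_setOf_eq]
      exact hemb_off S p.1 p.2
    · intro T hT
      have hT' : mem T := (hD T).1 hT
      ext e
      by_cases he : e ∈ Fix
      · rw [hT' e he]
        constructor
        · rintro (h | ⟨hne, _⟩)
          · exact h.1
          · exact absurd he hne
        · exact fun h => Or.inl ⟨h, he⟩
      · rw [hemb_off (proj T) e he]
        rfl
    · intro S _; rfl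
  rw [← hbij]; exact hcube'

end PosPart

end Antithetic

end Summit.CriticalPhenomena.PercolationContinuityZ3.Theorems
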